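import Summits.NavierStokesRegularity.NavierStokesRegularity.Theorems.StrainDoorsNearRecordGradientRate
import Literature.Analysis.FluidPDE.KNSSThm52Integrand
import HarnessLib

/-!
# StrainDoorsNearRecordClockRate — PART M §M11: TIME REGULARITY OF THE TYPE-I CLASS AND THE CLOCK LAW WITH A RATE

(Tree file 1 of 2 of PART M (§M11, ROUND 63 text D1); text of nsreg-p1 r63/StrainDoorsNearRecordClockRate.lean sha256 eef3c1babb00a640, split at the 400-line cap at § boundaries,
bodies verbatim.)

nsreg-p1 g36, ROUND-63 (helper lane of `stmt-NavierStokesRegularity-0056`, rung N0; 0 ledger writes by the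
planner — text for the S-lane to land `--supports stmt-NavierStokesRegularity-0056 --as helper`; tree file 4 of 5
of ROUND-63; bodies farm-certified inside `r63/StrainDoorsR63All.lean`, rc 0 · 0 warn · 0 sorry, std axioms).

ROUNDS 53/60 recorded the CLOCK IDENTITY at an interior space-time maximum of the scale-invariant vorticity
`(T − t)|ω|`: `|ω|² = (T − t)⟪ω, ∂ₜω⟫` (Fermat in time).  This file makes it QUANTITATIVE at NEAR-records of a
classical Type-I ancient solution, with no blow-up sequence: if `(0 − s)|ω(s,x)| ≤ W` along the world-line of the
point `x` (all `s < 0`) and `(0 − t)|ω(t,x)| ≥ W − δ`, then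
`((0 − t)³⟪ω, ∂ₜω⟫(t,x) − ((0 − t)|ω(t,x)|)²)² ≤ A(C₀)·W·δ`.
Mechanism: rescale to time `−1`; `G(s) = (0 − s)²|ω'(s,z)|²` is `≤ W²` for all `s < 0` and `≥ (W − δ)²` at `s = −1`;
its derivative `Γ = G'` exists (the vorticity equation holds pointwise for classical solutions:
`classical_vorticity_hasDerivAt`) and is Lipschitz near `−1` UNIFORMLY IN THE CLASS, because the KNSS smooth
representative has time-Lipschitz space derivatives of every order `k ≤ 3` (`exists_uniform_timeLipschitz`, a
fixed-window transfer of the KNSS a-priori estimate) and the class has uniform `C³` bounds; the elementary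
local Fermat-with-rate lemma `abs_le_two_sqrt_of_local_taylor` then gives `Γ(−1)² ≤ 4(W² − G(−1))(L + 2C) ≤ A·W·δ`,
and `Γ(−1) = 2[(0 − t)³⟪ω, ∂ₜω⟫ − ((0 − t)|ω|)²](t,x)` by the parabolic scale law (`λ⁶`).

* `window_transfer_fderiv₂_time`, `window_transfer_fderiv₃_time` — a.e.-to-everywhere transfer of time-Lipschitz
  bounds of `∇²U`, `∇³U` from the KNSS representative to the classical field;
* ★ `exists_uniform_timeLipschitz` — ONE constant `L(C₀)` with `‖∇ᵏu(t,x) − ∇ᵏu(s,x)‖ ≤ L|t − s|` for `k < 4`,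
  `t ≤ −1/4`, `t − 1 < s ≤ t`, for every classical Type-I solution of the class;
* ★ `classical_vorticity_hasDerivAt` — the vorticity equation `∂ₜω = Δω − ∇ω·u + ∇u·ω` as a `HasDerivAt` statement
  in time at every point, for classical solutions on `(−∞,0)`;
* `abs_le_two_sqrt_of_local_taylor` — 1-D Fermat with a rate at a near-maximum, local version (Lipschitz derivative
  on `|s − a| ≤ r`, a-priori bound `|G'(a)| ≤ C` for the far range): `|G'(a)| ≤ 2√((M − G(a))(L + C/r))`;
* ★★★ `typeI_nearRecord_clock_rate` — THE CLOCK LAW WITH A RATE (above).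

WHAT THIS IS NOT: a necessary condition at near-record points; nothing here excludes a blow-up; `0056` / `10661` /
NS regularity are NOT proved; the peak doors of PART K stay OPEN.  No new definitions; no sorry.
[cite: KochNadirashviliSereginSverak2009, §2 p. 5, (4.11); ChaeWolf2017RemovingDSS, §3 Step 2;
ConstantinFefferman1993, §1]
-/

noncomputable section

open MeasureTheory Set Function Filter Metric Real InnerProductSpace
open _root_.Topology
open scoped ENNReal NNReal RealInnerProductSpace ContDiff Laplacian
open Literature.Analysis Literature.Analysis.FluidPDE
open Literature.Analysis.FluidPDE.VorticityDirectionDynamics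

set_option linter.dupNamespace false
set_option maxSynthPendingDepth 3

namespace Summit.NavierStokesRegularity.NavierStokesRegularity.Theorems.StrainDoors

open Summit.NavierStokesRegularity.NavierStokesRegularity.Theorems.ArgmaxDoors

/-! ## §M11 Time regularity in the Type-I class and the pointwise vorticity equation (ROUND 63) -/

/-- Transfer of the KNSS time-Lipschitz window bound (4.11) of ORDER TWO to the classical field:
`‖D²w(τ,x) − D²w(σ,x)‖ ≤ L₂|τ − σ|` on `(1,T)` (copy of `window_transfer_fderiv_time`, one order up; the
drift `b(τ)` drops out of `D`, continuity of `τ ↦ D²w(τ,x)` removes the exceptional times). [folklore] -/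
theorem window_transfer_fderiv₂_time {T L₂ : ℝ}
    {w U : ℝ → (EuclideanSpace ℝ (Fin 3)) → (EuclideanSpace ℝ (Fin 3))} {b : ℝ → EuclideanSpace ℝ (Fin 3)}
    (hw : IsSmoothSpaceTimeOn (Ioo 0 T) w)
    (hae : ∀ᵐ τ ∂((volume : Measure ℝ).restrict (Ioo 0 T)), w τ =ᵐ[volume] fun x => U τ x + b τ)
    (hUs : ∀ τ ∈ Ioo 0 T, ContDiff ℝ ∞ (U τ))
    (hUL : ∀ σ ∈ Ioo 1 T, ∀ τ ∈ Ioo 1 T, ∀ x,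
      ‖iteratedFDeriv ℝ 2 (U τ) x - iteratedFDeriv ℝ 2 (U σ) x‖ ≤ L₂ * |τ - σ|) :
    ∀ σ ∈ Ioo 1 T, ∀ τ ∈ Ioo 1 T, ∀ x : EuclideanSpace ℝ (Fin 3),
      ‖fderiv ℝ (fderiv ℝ (w τ)) x - fderiv ℝ (fderiv ℝ (w σ)) x‖ ≤ L₂ * |τ - σ| := by
  have hSU : UniqueDiffOn ℝ (Ioo 0 T) := isOpen_Ioo.uniqueDiffOn
  have hsub1 : Ioo 1 T ⊆ Ioo 0 T := Ioo_subset_Ioo_left zero_le_one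
  have hwx : ∀ τ ∈ Ioo 0 T, Continuous (w τ) := fun τ hτ => (hw.contDiff_slice hτ).continuous
  have hDτ : ∀ x, ContinuousOn (fun τ => fderiv ℝ (fderiv ℝ (w τ)) x) (Ioo 1 T) := fun x =>
    (((hw.fderiv_slice hSU).continuousOn_fderiv_slice hSU).comp (continuousOn_id.prodMk continuousOn_const)
      (fun τ hτ => mk_mem_prod hτ (mem_univ x))).mono hsub1
  have hgood : ∀ᵐ τ ∂((volume : Measure ℝ).restrict (Ioo 0 T)),
      τ ∈ Ioo 0 T ∧ ∀ x, w τ x = U τ x + b τ := by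
    filter_upwards [hae, ae_restrict_mem measurableSet_Ioo] with τ hτ hτm
    refine ⟨hτm, fun x => ?_⟩
    have hc2 : Continuous fun x => U τ x + b τ := (hUs τ hτm).continuous.add continuous_const
    exact congr_fun ((Continuous.ae_eq_iff_eq volume (hwx τ hτm) hc2).1 hτ) x
  have hgood1 : ∀ᵐ τ ∂((volume : Measure ℝ).restrict (Ioo 1 T)),
      τ ∈ Ioo 0 T ∧ ∀ x, w τ x = U τ x + b τ :=
    ae_restrict_of_ae_restrict_of_subset hsub1 hgood
  have hDU : ∀ τ, (∀ y, w τ y = U τ y + b τ) → fderiv ℝ (w τ) = fderiv ℝ (U τ) := fun τ hτg => by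
    have e : w τ = fun y => U τ y + b τ := funext hτg
    rw [e]; funext y; exact fderiv_add_const _
  have hgg : ∀ σ τ : ℝ, σ ∈ Ioo 1 T → τ ∈ Ioo 1 T → (∀ y, w σ y = U σ y + b σ) →
      (∀ y, w τ y = U τ y + b τ) → ∀ x,
        ‖fderiv ℝ (fderiv ℝ (w τ)) x - fderiv ℝ (fderiv ℝ (w σ)) x‖ ≤ L₂ * |τ - σ| := by
    intro σ τ hσ hτ hσg hτg x
    rw [hDU τ hτg, hDU σ hσg, norm_fderiv_fderiv_sub_eq]
    exact hUL σ hσ τ hτ x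
  have hstep : ∀ τ ∈ Ioo 1 T, (∀ y, w τ y = U τ y + b τ) →
      ∀ σ ∈ Ioo 1 T, ∀ x, ‖fderiv ℝ (fderiv ℝ (w τ)) x - fderiv ℝ (fderiv ℝ (w σ)) x‖ ≤ L₂ * |τ - σ| := by
    intro τ hτ hτg σ₀ hσ₀ x
    have hcont : ContinuousOn
        (fun σ => ‖fderiv ℝ (fderiv ℝ (w τ)) x - fderiv ℝ (fderiv ℝ (w σ)) x‖ - L₂ * |τ - σ|) (Ioo 1 T) := by
      refine ContinuousOn.sub (continuousOn_const.sub (hDτ x)).norm ?_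
      exact continuousOn_const.mul (continuousOn_const.sub continuousOn_id).abs
    have key := ChaeWolf.le_of_ae_le_of_continuousOn (K := 0) hcont ?_ σ₀ hσ₀
    · linarith
    filter_upwards [hgood1, ae_restrict_mem measurableSet_Ioo] with σ hσ hσ1
    linarith [hgg σ τ hσ1 hτ hσ.2 hτg x]
  intro σ hσ τ₀ hτ₀ x
  have hcont : ContinuousOn
      (fun τ => ‖fderiv ℝ (fderiv ℝ (w τ)) x - fderiv ℝ (fderiv ℝ (w σ)) x‖ - L₂ * |τ - σ|) (Ioo 1 T) := by
    refine ContinuousOn.sub ((hDτ x).sub continuousOn_const).norm ?_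
    exact continuousOn_const.mul (continuousOn_id.sub continuousOn_const).abs
  have key := ChaeWolf.le_of_ae_le_of_continuousOn (K := 0) hcont ?_ τ₀ hτ₀
  · linarith
  filter_upwards [hgood1, ae_restrict_mem measurableSet_Ioo] with τ hτ hτ1
  linarith [hstep τ hτ1 hτ.2 σ hσ x]

/-- Transfer of the KNSS time-Lipschitz window bound (4.11) of ORDER THREE to the classical field:
`‖D³w(τ,x) − D³w(σ,x)‖ ≤ L₃|τ − σ|` on `(1,T)`. [folklore] -/
theorem window_transfer_fderiv₃_time {T L₃ : ℝ}
    {w U : ℝ → (EuclideanSpace ℝ (Fin 3)) → (EuclideanSpace ℝ (Fin 3))} {b : ℝ → EuclideanSpace ℝ (Fin 3)}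
    (hw : IsSmoothSpaceTimeOn (Ioo 0 T) w)
    (hae : ∀ᵐ τ ∂((volume : Measure ℝ).restrict (Ioo 0 T)), w τ =ᵐ[volume] fun x => U τ x + b τ)
    (hUs : ∀ τ ∈ Ioo 0 T, ContDiff ℝ ∞ (U τ))
    (hUL : ∀ σ ∈ Ioo 1 T, ∀ τ ∈ Ioo 1 T, ∀ x,
      ‖iteratedFDeriv ℝ 3 (U τ) x - iteratedFDeriv ℝ 3 (U σ) x‖ ≤ L₃ * |τ - σ|) :
    ∀ σ ∈ Ioo 1 T, ∀ τ ∈ Ioo 1 T, ∀ x : EuclideanSpace ℝ (Fin 3),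
      ‖fderiv ℝ (fderiv ℝ (fderiv ℝ (w τ))) x - fderiv ℝ (fderiv ℝ (fderiv ℝ (w σ))) x‖ ≤ L₃ * |τ - σ| := by
  have hSU : UniqueDiffOn ℝ (Ioo 0 T) := isOpen_Ioo.uniqueDiffOn
  have hsub1 : Ioo 1 T ⊆ Ioo 0 T := Ioo_subset_Ioo_left zero_le_one
  have hwx : ∀ τ ∈ Ioo 0 T, Continuous (w τ) := fun τ hτ => (hw.contDiff_slice hτ).continuous
  have hDτ : ∀ x, ContinuousOn (fun τ => fderiv ℝ (fderiv ℝ (fderiv ℝ (w τ))) x) (Ioo 1 T) := fun x =>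
    ((((hw.fderiv_slice hSU).fderiv_slice hSU).continuousOn_fderiv_slice hSU).comp
      (continuousOn_id.prodMk continuousOn_const) (fun τ hτ => mk_mem_prod hτ (mem_univ x))).mono hsub1
  have hgood : ∀ᵐ τ ∂((volume : Measure ℝ).restrict (Ioo 0 T)),
      τ ∈ Ioo 0 T ∧ ∀ x, w τ x = U τ x + b τ := by
    filter_upwards [hae, ae_restrict_mem measurableSet_Ioo] with τ hτ hτm
    refine ⟨hτm, fun x => ?_⟩
    have hc2 : Continuous fun x => U τ x + b τ := (hUs τ hτm).continuous.add continuous_const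
    exact congr_fun ((Continuous.ae_eq_iff_eq volume (hwx τ hτm) hc2).1 hτ) x
  have hgood1 : ∀ᵐ τ ∂((volume : Measure ℝ).restrict (Ioo 1 T)),
      τ ∈ Ioo 0 T ∧ ∀ x, w τ x = U τ x + b τ :=
    ae_restrict_of_ae_restrict_of_subset hsub1 hgood
  have hDU : ∀ τ, (∀ y, w τ y = U τ y + b τ) → fderiv ℝ (w τ) = fderiv ℝ (U τ) := fun τ hτg => by
    have e : w τ = fun y => U τ y + b τ := funext hτg
    rw [e]; funext y; exact fderiv_add_const _
  have hgg : ∀ σ τ : ℝ, σ ∈ Ioo 1 T → τ ∈ Ioo 1 T → (∀ y, w σ y = U σ y + b σ) →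
      (∀ y, w τ y = U τ y + b τ) → ∀ x,
        ‖fderiv ℝ (fderiv ℝ (fderiv ℝ (w τ))) x - fderiv ℝ (fderiv ℝ (fderiv ℝ (w σ))) x‖ ≤ L₃ * |τ - σ| := by
    intro σ τ hσ hτ hσg hτg x
    rw [hDU τ hτg, hDU σ hσg, norm_fderiv_fderiv_sub_eq, norm_iteratedFDeriv_fderiv_sub]
    exact hUL σ hσ τ hτ x
  have hstep : ∀ τ ∈ Ioo 1 T, (∀ y, w τ y = U τ y + b τ) →
      ∀ σ ∈ Ioo 1 T, ∀ x, ‖fderiv ℝ (fderiv ℝ (fderiv ℝ (w τ))) x -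
        fderiv ℝ (fderiv ℝ (fderiv ℝ (w σ))) x‖ ≤ L₃ * |τ - σ| := by
    intro τ hτ hτg σ₀ hσ₀ x
    have hcont : ContinuousOn
        (fun σ => ‖fderiv ℝ (fderiv ℝ (fderiv ℝ (w τ))) x - fderiv ℝ (fderiv ℝ (fderiv ℝ (w σ))) x‖ -
          L₃ * |τ - σ|) (Ioo 1 T) := by
      refine ContinuousOn.sub (continuousOn_const.sub (hDτ x)).norm ?_
      exact continuousOn_const.mul (continuousOn_const.sub continuousOn_id).abs
    have key := ChaeWolf.le_of_ae_le_of_continuousOn (K := 0) hcont ?_ σ₀ hσ₀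
    · linarith
    filter_upwards [hgood1, ae_restrict_mem measurableSet_Ioo] with σ hσ hσ1
    linarith [hgg σ τ hσ1 hτ hσ.2 hτg x]
  intro σ hσ τ₀ hτ₀ x
  have hcont : ContinuousOn
      (fun τ => ‖fderiv ℝ (fderiv ℝ (fderiv ℝ (w τ))) x - fderiv ℝ (fderiv ℝ (fderiv ℝ (w σ))) x‖ -
        L₃ * |τ - σ|) (Ioo 1 T) := by
    refine ContinuousOn.sub ((hDτ x).sub continuousOn_const).norm ?_
    exact continuousOn_const.mul (continuousOn_id.sub continuousOn_const).abs
  have key := ChaeWolf.le_of_ae_le_of_continuousOn (K := 0) hcont ?_ τ₀ hτ₀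
  · linarith
  filter_upwards [hgood1, ae_restrict_mem measurableSet_Ioo] with τ hτ hτ1
  linarith [hstep τ hτ1 hτ.2 σ hσ x]

/-- **Uniform time-Lipschitz bounds of orders `0 ≤ k ≤ 3` in the Type-I class.**  For every `C₀ ≥ 0` there
is `L = L(C₀) ≥ 0` such that every classical Type-I solution on `(−∞,0) × ℝ³` satisfies, for `t ≤ −1/4`,
`t − 1 < s ≤ t`, every `x` and `k = 0, 1, 2, 3`: `‖Dᵏu(t,x) − Dᵏu(s,x)‖ ≤ L|t − s|` (KNSS §4 (4.11) on the
window `(t − 2, t + 1/8)`; orders `0, 1` are the tree's `ChaeWolf.exists_uniform_lipschitz`,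
`exists_uniform_gradLipschitz`). [cite: KochNadirashviliSereginSverak2009, §4 (4.11)] -/
theorem exists_uniform_timeLipschitz {C₀ : ℝ} (hC₀ : 0 ≤ C₀) :
    ∃ L : ℝ, 0 ≤ L ∧ ∀ {u : ℝ → EuclideanSpace ℝ (Fin 3) → EuclideanSpace ℝ (Fin 3)}
      {p : ℝ → EuclideanSpace ℝ (Fin 3) → ℝ},
      IsClassicalNSSolutionOn (Iio 0) 1 0 u p → HasTypeIDecay C₀ u →
        ∀ t ≤ -(1 / 4 : ℝ), ∀ s, t - 1 < s → s ≤ t → ∀ x, ∀ k < 4,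
          ‖iteratedFDeriv ℝ k (u t) x - iteratedFDeriv ℝ k (u s) x‖ ≤ L * |t - s| := by
  obtain ⟨K, L₀, hK, hL₀, hKL⟩ := ChaeWolf.exists_uniform_lipschitz hC₀
  obtain ⟨K₂, L₁, hK₂, hL₁, hG⟩ := exists_uniform_gradLipschitz hC₀
  obtain ⟨Cw, Lw, N, hwin⟩ :=
    KNSS2009_regularity_boundedWeak_window_holds (3 * C₀) (17 / 8) (by norm_num)
  -- the window based at a time `t ≤ -1/4`: orders two and three
  have hwindow : ∀ {u : ℝ → EuclideanSpace ℝ (Fin 3) → EuclideanSpace ℝ (Fin 3)}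
      {p : ℝ → EuclideanSpace ℝ (Fin 3) → ℝ},
      IsClassicalNSSolutionOn (Iio 0) 1 0 u p → HasTypeIDecay C₀ u →
      ∀ t ≤ -(1 / 4 : ℝ), ∀ s, t - 1 < s → s ≤ t → ∀ x,
        ‖fderiv ℝ (fderiv ℝ (u t)) x - fderiv ℝ (fderiv ℝ (u s)) x‖ ≤ Lw 2 1 * |t - s| ∧
        ‖fderiv ℝ (fderiv ℝ (fderiv ℝ (u t))) x - fderiv ℝ (fderiv ℝ (fderiv ℝ (u s))) x‖ ≤
          Lw 3 1 * |t - s| := by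
    intro u p hcl hI t ht
    set a : ℝ := t - 2 with ha
    set w : ℝ → EuclideanSpace ℝ (Fin 3) → EuclideanSpace ℝ (Fin 3) := fun τ => u (τ + a) with hw
    have hIoo : Ioo a (a + 17 / 8) ⊆ Iio 0 := fun τ hτ => by
      simp only [mem_Iio]; linarith [hτ.2]
    have hneg : ∀ τ ∈ Ioo (0 : ℝ) (17 / 8), τ + a < -(1 / 8 : ℝ) := fun τ hτ => by
      linarith [hτ.2]
    have hcl' : IsClassicalNSSolutionOn (Ioo a (a + 17 / 8)) 1 0 u p :=
      hcl.mono hIoo (uniqueDiffOn_Ioo _ _)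
    have hbdd : IsBoundedOn (Ioo a (a + 17 / 8)) u :=
      ⟨3 * C₀, fun τ hτ x => ChaeWolf.typeI_norm_le_three_mul hC₀ hI (by linarith [hτ.2]) x⟩
    have hweak : IsBoundedWeakNSSolutionOn (Ioo 0 (17 / 8)) isOpen_Ioo 1 w :=
      (hcl'.isBoundedWeakNSSolutionOn hbdd).comp_add_right a (J := Ioo 0 (17 / 8)) isOpen_Ioo
        fun τ => by
          simp only [mem_Ioo]
          constructor <;> intro h <;> constructor <;> linarith [h.1, h.2]
    have hM : ∀ τ ∈ Ioo (0 : ℝ) (17 / 8), ∀ x, ‖w τ x‖ ≤ 3 * C₀ := fun τ hτ x =>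
      ChaeWolf.typeI_norm_le_three_mul hC₀ hI (hneg τ hτ) x
    obtain ⟨U, b, -, -, -, hae, hUs, -, -, hUL, -⟩ := hwin hweak hM
    have hws : IsSmoothSpaceTimeOn (Ioo 0 (17 / 8)) w := by
      have h1 := hcl.smooth_velocity.comp_add_right a
      refine h1.mono fun τ hτ => ?_
      simp only [mem_preimage, mem_Iio]
      linarith [hneg τ hτ]
    have htm2 := window_transfer_fderiv₂_time hws hae hUs (hUL 1 one_pos 2)
    have htm3 := window_transfer_fderiv₃_time hws hae hUs (hUL 1 one_pos 3)
    have h2 : (2 : ℝ) ∈ Ioo (1 : ℝ) (17 / 8) := ⟨by norm_num, by norm_num⟩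
    have e2 : w 2 = u t := by simp only [hw, ha]; congr 1; ring
    intro s hs1 hs2 x
    have hs' : s - a ∈ Ioo (1 : ℝ) (17 / 8) := ⟨by rw [ha]; linarith, by rw [ha]; linarith⟩
    have key2 := htm2 (s - a) hs' 2 h2 x
    have key3 := htm3 (s - a) hs' 2 h2 x
    have es : w (s - a) = u s := by simp only [hw]; congr 1; ring
    have eabs : |(2 : ℝ) - (s - a)| = |t - s| := by rw [ha]; congr 1; ring
    rw [e2, es, eabs] at key2 key3
    exact ⟨key2, key3⟩
  refine ⟨max (max L₀ L₁) (max (Lw 2 1) (Lw 3 1)), le_max_of_le_left (le_max_of_le_left hL₀), ?_⟩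
  intro u p hcl hI t ht s hs1 hs2 x k hk
  have hs4 : s ≤ -(1 / 4 : ℝ) := hs2.trans ht
  have habs : 0 ≤ |t - s| := abs_nonneg _
  interval_cases k
  · rw [← norm_sub_eq_norm_iteratedFDeriv_zero_sub]
    exact ((hKL hcl hI).2 s hs4 t ht x).trans
      (mul_le_mul_of_nonneg_right (le_max_of_le_left (le_max_left _ _)) habs)
  · rw [← norm_fderiv_sub_eq_norm_iteratedFDeriv_one_sub]
    exact ((hG hcl hI).2 s hs4 t ht x).trans
      (mul_le_mul_of_nonneg_right (le_max_of_le_left (le_max_right _ _)) habs)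
  · rw [← norm_fderiv_fderiv_sub_eq]
    exact ((hwindow hcl hI t ht s hs1 hs2 x).1).trans
      (mul_le_mul_of_nonneg_right (le_max_of_le_right (le_max_left _ _)) habs)
  · rw [← norm_iteratedFDeriv_fderiv_sub, ← norm_fderiv_fderiv_sub_eq]
    exact ((hwindow hcl hI t ht s hs1 hs2 x).2).trans
      (mul_le_mul_of_nonneg_right (le_max_of_le_right (le_max_right _ _)) habs)

/-- **The pointwise vorticity equation of a classical solution, as a time derivative at a frozen point.**
For a classical Navier–Stokes solution (`ν = 1`, `f = 0`) on `(−∞,0) × ℝ³`, every `s < 0` and `x`: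
`τ ↦ ω(τ,x)` has at `s` the derivative `Δω(s,x) − ∇ω(s,x)[u(s,x)] + ∇u(s,x)[ω(s,x)]` (tree:
`∂ₜ curl = curl ∂ₜ`, `IsClassicalNSSolutionOn.curl_timeDerivWithin_eq`). [cite: Tao2011, §10 (10.18)] -/
theorem classical_vorticity_hasDerivAt
    {u : ℝ → (EuclideanSpace ℝ (Fin 3)) → (EuclideanSpace ℝ (Fin 3))} {p : ℝ → (EuclideanSpace ℝ (Fin 3)) → ℝ}
    (hsol : IsClassicalNSSolutionOn (Iio 0) 1 0 u p) {s : ℝ} (hs : s < 0) (x : EuclideanSpace ℝ (Fin 3)) :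
    HasDerivAt (fun τ => curl (u τ) x)
      ((Δ (curl (u s))) x - fderiv ℝ (curl (u s)) x (u s x) + fderiv ℝ (u s) x (curl (u s) x)) s := by
  have hS : UniqueDiffOn ℝ (Iio (0 : ℝ)) := isOpen_Iio.uniqueDiffOn
  have hs' : s ∈ Iio (0 : ℝ) := hs
  have hω : IsSmoothSpaceTimeOn (Iio 0) (vorticity u) := (hsol.smooth_velocity.fderiv_slice hS).clm_comp curlCLM
  have hd : HasDerivAt (fun τ => curl (u τ) x) (timeDerivWithin (Iio 0) (vorticity u) s x) s :=
    (hω.hasDerivWithinAt_timeDerivWithin hS hs' x).hasDerivAt (Iio_mem_nhds hs)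
  have hval : timeDerivWithin (Iio 0) (vorticity u) s x =
      (Δ (curl (u s))) x - fderiv ℝ (curl (u s)) x (u s x) + fderiv ℝ (u s) x (curl (u s) x) := by
    rw [← hsol.smooth_velocity.curl_timeDerivWithin_of_uniqueDiffOn hS hs' x,
      hsol.curl_timeDerivWithin_eq hS hs' x]
    have h0 : curl ((0 : ℝ → (EuclideanSpace ℝ (Fin 3)) → (EuclideanSpace ℝ (Fin 3))) s) x = 0 := by
      rw [curl_eq_curlCLM, show ((0 : ℝ → (EuclideanSpace ℝ (Fin 3)) → (EuclideanSpace ℝ (Fin 3))) s) =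
        fun _ => (0 : EuclideanSpace ℝ (Fin 3)) from rfl, fderiv_fun_const]
      simp
    rw [h0, add_zero, one_smul]
    rfl
  rwa [hval] at hd

/-- **Fermat with a rate in one variable, local version.**  If `G` is differentiable with derivative `Γ`
on `|s − a| ≤ r`, `Γ` is `L`-Lipschitz AT `a` there (`|Γ s − Γ a| ≤ L|s − a|`), `G ≤ M` there and
`|Γ a| ≤ C`, then `|Γ a| ≤ 2√((M − G a)(L + C/r))` (two one-sided Taylor estimates for `0 < h ≤ r`, the
crude bound for `h > r`, then `linear_le_two_sqrt_of_forall_quadratic`). [folklore] -/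
theorem abs_le_two_sqrt_of_local_taylor {G Γ : ℝ → ℝ} {a r L C M : ℝ} (hr : 0 < r) (hL : 0 ≤ L)
    (hC : 0 ≤ C) (hG : ∀ s, |s - a| ≤ r → HasDerivAt G (Γ s) s)
    (hΓ : ∀ s, |s - a| ≤ r → |Γ s - Γ a| ≤ L * |s - a|) (hM : ∀ s, |s - a| ≤ r → G s ≤ M)
    (hCa : |Γ a| ≤ C) : |Γ a| ≤ 2 * √((M - G a) * (L + C / r)) := by
  have hMa : 0 ≤ M - G a := by linarith [hM a (by simp [hr.le])]
  refine linear_le_two_sqrt_of_forall_quadratic hMa (by positivity) fun h hh => ?_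
  have hCr : 0 ≤ C / r * h ^ 2 := by positivity
  by_cases hhr : h ≤ r
  · -- one-sided Taylor on the segment from `a` to `a + η`, `|η| = h`
    have taylor : ∀ η : ℝ, |η| = h → Γ a * η ≤ (M - G a) + L * h ^ 2 := by
      intro η hη
      have hfd : ∀ s, |s - a| ≤ r →
          HasDerivAt (fun s => G s - Γ a * s) (Γ s - Γ a) s := fun s hs => by
        exact ((hG s hs).sub ((hasDerivAt_id' s).const_mul (Γ a))).congr_deriv (by ring)
      have hMη : G (a + η) ≤ M := hM (a + η) (by rw [add_sub_cancel_left, hη]; exact hhr)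
      rcases le_total 0 η with hη0 | hη0
      · have hηh : η = h := by rw [← hη, abs_of_nonneg hη0]
        have hseg : ∀ s ∈ Icc a (a + η), |s - a| ≤ r := fun s hs => by
          rw [abs_of_nonneg (by linarith [hs.1])]; linarith [hs.2]
        have key := norm_image_sub_le_of_norm_deriv_le_segment' (f := fun s => G s - Γ a * s)
          (C := L * h) (fun s hs => (hfd s (hseg s hs)).hasDerivWithinAt)
          (fun s hs => by
            have h1 := hΓ s (hseg s (Ico_subset_Icc_self hs))
            rw [Real.norm_eq_abs]
            refine h1.trans (mul_le_mul_of_nonneg_left ?_ hL)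
            rw [abs_of_nonneg (by linarith [hs.1])]; linarith [hs.2])
          (a + η) ⟨by linarith, le_rfl⟩
        rw [Real.norm_eq_abs, add_sub_cancel_left] at key
        have k2 := (abs_le.1 key).1
        have e : L * h * η = L * h ^ 2 := by rw [hηh]; ring
        linarith
      · have hηh : η = -h := by rw [← hη, abs_of_nonpos hη0, neg_neg]
        have hseg : ∀ s ∈ Icc (a + η) a, |s - a| ≤ r := fun s hs => by
          rw [abs_of_nonpos (by linarith [hs.2])]; linarith [hs.1]
        have key := norm_image_sub_le_of_norm_deriv_le_segment' (f := fun s => G s - Γ a * s)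
          (C := L * h) (fun s hs => (hfd s (hseg s hs)).hasDerivWithinAt)
          (fun s hs => by
            have h1 := hΓ s (hseg s (Ico_subset_Icc_self hs))
            rw [Real.norm_eq_abs]
            refine h1.trans (mul_le_mul_of_nonneg_left ?_ hL)
            rw [abs_of_nonpos (by linarith [hs.2])]; linarith [hs.1])
          a ⟨by linarith, le_rfl⟩
        rw [Real.norm_eq_abs, show a - (a + η) = -η by ring] at key
        have k2 := (abs_le.1 key).2
        have e : L * h * -η = L * h ^ 2 := by rw [hηh]; ring
        linarith
    rcases le_total 0 (Γ a) with hpos | hneg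
    · rw [abs_of_nonneg hpos]
      linarith [taylor h (abs_of_pos hh)]
    · rw [abs_of_nonpos hneg]
      have := taylor (-h) (by rw [abs_neg, abs_of_pos hh])
      linarith
  · have hhr' : r < h := lt_of_not_ge hhr
    have h1 : |Γ a| * h ≤ C / r * h ^ 2 := by
      rw [div_mul_eq_mul_div, le_div_iff₀ hr]
      calc |Γ a| * h * r ≤ C * h * r := by gcongr
        _ ≤ C * h * h := mul_le_mul_of_nonneg_left hhr'.le (by positivity)
        _ = C * h ^ 2 := by ring
    nlinarith

end Summit.NavierStokesRegularity.NavierStokesRegularity.Theorems.StrainDoors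

end
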